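import Summits.AtomisticToContinuum.Crystallization.Theorems.FluxTubeKeplerFluxCellKeplerSingleScale
import Summits.AtomisticToContinuum.Crystallization.Theorems.ChessboardParticlePlanesPeriodicWindowsIffCrystallization

/-!
# F4 on-path lemma for the forward rung `OnePointRung` (cell ladder over `FluxTubeKepler.FloorGivesLayered`)

`Crystallization → OnePointRung` (indeed `Crystallization → CellRung 𝓢` for every set of cells `𝓢`): the
conclusion of every member is the periodic-windows clause, which the sub-problem statement gives for every
ground-state sequence through the landed hull-criterion converse
`ChessboardParticlePlanesPeriodicWindowsIffCrystallization.periodicWindows_of_crystallization`.  Self-contained copy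
(sub-namespace `OnPath`) of the definitions of `Lines/OnePointRung.lean`; the canonical declarations
`CellLadder.OnePointRung`, `CellLadder.OnePointRung_of_Crystallization` live there with the same text.  No `sorry`.
-/

noncomputable section

namespace Summit.AtomisticToContinuum.Crystallization.Cruxes.FluxCellKepler.CellLadder.OnPath

open Filter Topology
open Literature.MathematicalPhysics.StatisticalMechanics
open Summit.AtomisticToContinuum.Crystallization.Theorems.FluxCellKeplerSingleScale (LayeredGood)

local notation "E3" => EuclideanSpace ℝ (Fin 3)

/-- FLOOR(P₀) (verbatim copy of `CellLadder.Floor`). -/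
def Floor (P₀ : PeriodicConfiguration 3) : Prop :=
  ∀ (N : ℕ) (x : Fin N → E3), IsGroundState lennardJones x →
    (N : ℝ) * P₀.energyPerParticle lennardJones ≤ interactionEnergy lennardJones x

/-- BUDGET(P₀) on the cells `𝓢` (verbatim copy of `CellLadder.Budget`). -/
def Budget (𝓢 : Set (ℝ × ℝ)) (P₀ : PeriodicConfiguration 3) : Prop :=
  ∀ R η : ℝ, (R, η) ∈ 𝓢 → 0 < R → 0 < η → ∃ c : ℝ, 0 < c ∧
    ∀ (N : ℕ) (x : Fin N → E3), IsGroundState lennardJones x →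
      c * (Nat.card {i : Fin N // ¬ LayeredGood R η x i} : ℝ) ≤
        interactionEnergy lennardJones x - (N : ℝ) * P₀.energyPerParticle lennardJones

/-- Periodic windows along `x` (verbatim copy of `CellLadder.HasPeriodicWindows`). -/
def HasPeriodicWindows (x : (N : ℕ) → (Fin N → E3)) : Prop :=
  ∃ P : PeriodicConfiguration 3, ∀ R ε : ℝ, 0 < ε → ∃ᶠ N in atTop, ∃ t : E3,
    (∀ s ∈ P.points, ‖s‖ ≤ R → ∃ i : Fin N, dist (x N i + t) s ≤ ε) ∧
    (∀ i : Fin N, ‖x N i + t‖ ≤ R → ∃ s ∈ P.points, dist (x N i + t) s ≤ ε)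

/-- The graded family (verbatim copy of `CellLadder.CellRung`). -/
def CellRung (𝓢 : Set (ℝ × ℝ)) : Prop :=
  ∀ P₀ : PeriodicConfiguration 3, Floor P₀ → Budget 𝓢 P₀ →
    ∀ x : (N : ℕ) → (Fin N → E3), (∀ N, IsGroundState lennardJones (x N)) → HasPeriodicWindows x

/-- The one cell (verbatim copy of `CellLadder.cell`). -/
def cell (η₀ : ℝ) : Set (ℝ × ℝ) := {((6 : ℝ) / 5, η₀)}

/-- Deciding rung (verbatim copy of `CellLadder.OnePointRung`). -/
def OnePointRung : Prop := ∃ η₀ : ℝ, 0 < η₀ ∧ CellRung (cell η₀)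

/-- ON-PATH for every member: `Crystallization → CellRung 𝓢`. -/
theorem cellRung_of_crystallization (𝓢 : Set (ℝ × ℝ)) (h : _root_.Crystallization) : CellRung 𝓢 :=
  fun _ _ _ x hx =>
    Theorems.ChessboardParticlePlanesPeriodicWindowsIffCrystallization.periodicWindows_of_crystallization h x hx

/-- **F4 — ON-PATH for the deciding rung** (`aesop safe apply`, so the tribunal's `S → C` portfolio finds it). -/
@[aesop safe apply]
theorem OnePointRung_of_Crystallization (h : _root_.Crystallization) : OnePointRung :=
  ⟨1, one_pos, cellRung_of_crystallization _ h⟩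

example : _root_.Crystallization → OnePointRung := OnePointRung_of_Crystallization

end Summit.AtomisticToContinuum.Crystallization.Cruxes.FluxCellKepler.CellLadder.OnPath

end
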